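import Literature.IUT.HodgeArakelov.SubgraphReferenceGenuineIdentificationTate
import Literature.IUT.HodgeArakelov.BadPlaceSettingAtModelTate
import HarnessLib

/-!
# [IUTchII] Prop. 2.2 (i)′ — the FULLY GENUINE closer AT THE [EtTh] TATE MODEL `ThetaSetting.modelTate p`: every
# `Prop`-fact binder of the [EtTh] §1–2 package a theorem (proof-only; C-R33 / K4 RE-CLOSE sibling, node `IUTchII:Prop2.2(i)`)

S. Mochizuki, *Inter-universal Teichmüller theory II*, kurims manuscript (Dec. 2020), §1 Prop. 1.2 (i) p. 25, §2 Prop. 2.1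
p. 64, Prop. 2.2 (i) p. 66 l. 27–42, Rmk. 2.1.1 (ii); *Inter-universal Teichmüller theory I* (May 2020) §2 Cor. 2.3 p. 47,
Def. 3.1 (e) p. 62 [claim: Mochizuki2012, status: disputed] (IUTchII §2 Prop 2.2 (i), kurims p.66; D-0012 claim key — NOTHING
of the series is asserted here); S. Mochizuki, *The étale theta function …*, Publ. RIMS **45** (2009) [EtTh], §1 pp. 11–14,
Prop. 1.5 (iii) p. 23, Def. 2.5 p. 39, Def. 2.13 p. 46 (PRIMS PDF pages) [cite: MochizukiEtTh2009, Def 2.13 p.46];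
[SemiAnbd] §6 [cite: MochizukiSemiAnbd2006, §6 pp.69-71]; J.-P. Serre, *A Course in Arithmetic*, Ch. II §3.1 Prop. 7
(«`ℚ_p` contains the `(p−1)`-th roots of unity») [cite: Serre1973, Ch. II §3.1 Prop. 7].
Cell `abc-iut`, seat abc-iut-w5-d162 (gen 7); R-C letter K / plan C-R33 «K4 RE-CLOSE», row «K4-RECLOSE-L6-IUTchII»
(abc-iut-c312-2 `CONE-K4-RECLOSE.tsv` v3: node `IUTchII:Prop2.2(i)`, class RECLOSABLE; the node's closers
`prop22_i'_of_cor23iii` / `prop22_i'_of_cor23iii_bridge` (abc-iut-w4-d034 / w5-d086) bind the refuted-closure FACT head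
F-2595 `StableCurveTemperedData.Cor23iii`; abc-iut-w6-d005's fully genuine closer `prop22_i'_xuu_genuineEnv_of_outer`
(`SubgraphReferenceGenuineIdentificationTate.lean`, outer-`G_K`-stability route, NO F-2595) still binds the [EtTh] §1–2
package `hC`, `hS`, `h15` (= F-0591 `Prop15iii`, refuted-closure), `hζ`, `hη`, `hZ` BY NAME).  PROOF-ONLY: no definition,
no instance, no new named fact; every input consumed BY NAME (pattern and data of record: abc-iut-w5-d233's
`BadPlaceSettingAtModelTate`, p453435).

WHAT IS PROVED.  `prop22_i'_genuineEnv_of_outer_modelTate` — at the stage-2 Tate model `modelTate p = modelχq p 1 2`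
(abc-iut-L2-t5; `K = ℚ_p`, `q_X = p²`), for every prime `p`, odd prime `l` with `4l ∣ p − 1`, level `N` and cyclotome
identification `μ` (DATA; inhabited: abc-iut-L2-t8 `modelχq_nonempty_cyclotomeMod`), over the data of record (the
`inr`-section étale-theta datum carrying `η̈♯ = etaDdχq`, the choice `X̲̲` with `Π^tp_X̲̲ = Huuχq`, the empty cusp labelling):
abc-iut-w6-d005's FULLY GENUINE Prop. 2.2 (i)′ closer with EVERY [EtTh]-side `Prop` binder a theorem of the tree — `hC`
(`compat_modelχq`, abc-iut-f-149), `hS` (`ThetaSetting.modelχq_sec2Hyps`, abc-iut-L2-t8), `h15` = F-0591 AT THE INSTANCE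
(`prop15iii_etaleThetaDataOfClass_etaDdχq`, abc-iut-L2-t6 over abc-iut-w5-d171's `kummerCoreχq`), `IsEtThOrigin` / `hYcl`
(abc-iut-L2-t5), `hζ` («`K ∋ ζ_{4l}`» ⟸ `4l ∣ p − 1`, abc-iut-w5-d233/w5-d125), `hη` (abc-iut-w4-d010's root-lift cocycle),
`hZ` («`(l·Δ_Θ)(M) ≅ Ẑ`», abc-iut-w5-d163's `ModelCyclotomes.nonempty_lDeltaQuot_rigidData_mulEquiv_zHat`).  What remains
quantified is print-shaped DATA and print's own hypotheses ONLY: the special-fibre data of the genuine curve `X̲̲_v`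
(`d₀`, `Sf`, `h36`, `Σ ⊆ Σ̂`, `Π_ℍ`, `Π̂_ℍ`, `cuspMeetsH` — abc-iut-L3's `SpecialFibreOrigin` lane constructs none of it for
the model), the reference pair `R` with `hG` (F-1782 `GroupTheoretic`, PREDICATE class) and the choice `hbullet`
(`Π_{v•} := Π^tp_{X̲̲,ℍ}`), `hOut` («`ℍ = Γ•_X` is `G_K`-stable», Rmk. 2.1.1 (ii)), the Prop. 2.1 / Prop. 1.4 outputs `T`, `D'`
and the pointed inversion `ι₀` over the genuine environment.  ZERO `Prop`-fact binders; in particular NO F-2595 and NO F-0591.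
Node-level reading (C-R33): at the genuine (non-toy) carrier `modelTate` the node `IUTchII:Prop2.2(i)` has a closer binding no
refuted-closure FACT head.

HONEST LABEL: `modelTate` is a SEMI-SYNTHETIC model of the typed [EtTh] §1 interface (not the tempered `π₁` of a curve; no
theta FUNCTION): joint-satisfiability / instance-form evidence (OUR kernel check that the closer's [EtTh]-side hypotheses are
realised TOGETHER at one genuine carrier) — not a claim about print; the special-fibre data of `X̲̲_v` over the model stay
DATA binders; re-closed-at-a-carrier ≠ proved-in-print; the [IUTchII] claim key `Mochizuki2012` is DISPUTED (D-0012) and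
nothing of it is asserted; no side is taken on [IUTchIII] Cor. 3.12; typed ≠ proved; nothing here says abc is proved or refuted.
-/

noncomputable section

namespace Literature.IUT.HodgeArakelov

open Literature.AnabelianGeometry.EtaleTheta Literature.AnabelianGeometry.SemiGraphs Literature.IUT.HodgeTheaters
open Literature.AnabelianGeometry.EtaleTheta.SettingModel
open EtaleThetaDataOfSetting
open scoped Literature.AnabelianGeometry.EtaleTheta
open scoped Pointwise

namespace ModelTateCarriers

variable (p : ℕ) [Fact p.Prime] (l : ℕ+) (hl : Odd (l : ℕ)) (hlp : (l : ℕ).Prime) (hdvd : 4 * (l : ℕ) ∣ p - 1) {N : ℕ+}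
  (μ : (ThetaSetting.modelχq p 1 2 even_two).CyclotomeMod l N)

/-- **IUTchII:Prop2.2(i)′ — abc-iut-w6-d005's FULLY GENUINE closer AT THE TATE MODEL, NO `Prop`-fact binder**: at the
bad-place setting `S := BadPlaceSetting.ofUnderline` of the Tate curve of `modelTate p` (every [EtTh]-side argument a theorem of
the tree), the genuine re-based B8 environment `Env` and abc-iut-L5's [IUTchI] §2 datum of the GENUINE curve `X̲̲_v`
(`temperedCurveXuuOfLevelData`), `Prop22_i' R T D' ι₀` holds for every Prop. 2.1 output `T`, Prop. 1.4 output `D'` and pointed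
inversion `ι₀` over `Env`, from `hG` (F-1782, predicate), the choice `hbullet`, `hOut` (Rmk. 2.1.1 (ii)) and the special-fibre
DATA of `X̲̲_v`.  The F-0591 binder `h15` of the generic closer is abc-iut-L2-t6's THEOREM at the `inr`-section datum; `hC`,
`hS`, `IsEtThOrigin`, `hYcl`, `hζ`, `hη`, `hZ` likewise theorems. [claim: Mochizuki2012, status: disputed]
(IUTchII §2 Prop 2.2 (i), kurims pp.66-67; IUTchI §2 Cor 2.3, kurims p.47) -/
theorem prop22_i'_genuineEnv_of_outer_modelTate :
    let hC := compat_modelχq p 1 2 even_two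
    let hS := ThetaSetting.modelχq_sec2Hyps p 1 2 even_two
    let K₀ := (kummerCoreχq p 1 2 even_two).toKummerDataOfSection SemidirectProduct.inr (continuous_inrχq p 1 2)
        (fun _ => rfl) (map_inr_GK_le_GtpY_modelχq' p 1 2 even_two) (map_inr_GKdd_le_GtpYdd_modelχq' p 1 2 even_two)
    let C := (K₀.etaleThetaDataOfClass (etaDdχq p 1 2 even_two)).doubleUnderlineχqOfEtaRes p 1 2 l hl
        (eta_res_etaDdχq p 1 2 even_two l hl)
    let h15 : Literature.AnabelianGeometry.EtaleTheta.ThetaSetting.Prop15iii _ hC :=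
      prop15iii_etaleThetaDataOfClass_etaDdχq p hC SemidirectProduct.inr
        (continuous_inrχq p 1 2) (fun _ => rfl) (map_inr_GK_le_GtpY_modelχq' p 1 2 even_two)
        (map_inr_GKdd_le_GtpYdd_modelχq' p 1 2 even_two)
    let L : C.CuspLabels := ⟨fun _ => ∅, fun _ => ∅, fun _ => rfl⟩
    let hO := ThetaSetting.modelχq_isEtThOrigin p 1 2 even_two
    let hYcl := hYcl_modelχq p 1 2 even_two
    let hp2 := ne_two_of_four_mul_dvd_pred p l.pos hdvd
    let hpl := ne_of_four_mul_dvd_pred p l.pos hdvd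
    let hζ := exists_isPrimitiveRoot_K_modelχq p 1 2 even_two l.pos hdvd
    let hη := EtaleThetaDataOfSetting.modN_rootLift_mem_thetaCocycles C hC hS μ
    let hZ : Nonempty (ModelCyclotomes.lDeltaQuot (C.rigidData μ hC hS h15 L) ≃* Literature.IUT.HodgeTheaters.ZHat) :=
      ModelCyclotomes.nonempty_lDeltaQuot_rigidData_mulEquiv_zHat C μ hC hS h15 L hO hYcl hlp.ne_zero
    let Sb := BadPlaceSetting.ofUnderline C μ hC hS hlp hp2 hpl hζ hη
    let Env : EnvOfGroup Sb.toThetaSetting (Pi C) :=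
      (ThetaSetting.envOfGroup (C.rigidData μ hC hS h15 L) (ThetaSetting.SideData.ofDoubleUnderline C μ hC hS hlp hp2 hpl hζ hη)
            (ThetaSetting.t1Space_Huu C) (ThetaSetting.isClosed_ker_aug_thetaEnvData C μ hC hS) hZ (Pi C)
            ⟨ContinuousMulEquiv.refl _⟩).transportAlong
        (ThetaSetting.envOfGroup (C.rigidData μ hC hS h15 L) (ThetaSetting.SideData.ofDoubleUnderline C μ hC hS hlp hp2 hpl hζ hη)
            (ThetaSetting.t1Space_Huu C) (ThetaSetting.isClosed_ker_aug_thetaEnvData C μ hC hS) hZ (Pi C)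
            ⟨ContinuousMulEquiv.refl _⟩).isoX
    ∀ (d₀ : (ThetaSetting.modelχq p 1 2 even_two).toTemperedCurve.GroupLevelData)
      (Sf : SpecialFibreData ((C.temperedCurveXuuOfLevelData C.l_ne_zero d₀).toTemperedArithmeticGroup
        (C.groupLevelDataXuu C.l_ne_zero d₀)))
      (h36 : Sf.Gc.Prop36Hypotheses) (Sigma SigmaHat : Set ℕ) (hsub : Sigma ⊆ SigmaHat) (hne : Sigma.Nonempty)
      (hprime : ∀ q ∈ SigmaHat, q.Prime) (hpS : p ∉ Sigma) (TpH : Subgroup Sf.chart.G)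
      (HatH : Subgroup (TemperedGraphGroupData.exists_completion_of_prop36 Sf.Gc h36 Sf.chart).choose)
      (hle : TpH.map (TemperedGraphGroupData.exists_completion_of_prop36 Sf.Gc h36
        Sf.chart).choose_spec.choose.toMonoidHom ≤ HatH)
      (cuspMeetsH : {x : (C.temperedCurveXuuOfLevelData C.l_ne_zero d₀).Pt //
        (C.temperedCurveXuuOfLevelData C.l_ne_zero d₀).IsCusp x} → Prop)
      (R : SubgraphReference Sb) (T : TemperedCoverings Sb (Pi C)) (D' : EtaleThetaData Sb.toThetaSetting (Pi C))
      (ι₀ : PointedInversion Env D') (_hG : R.GroupTheoretic)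
      (_hbullet : R.refBullet =
        (StableCurveTemperedData.ofSpecialFibre _ (C.groupLevelDataXuu C.l_ne_zero d₀) Sf h36 Sigma SigmaHat hsub hne
            hprime hpS TpH HatH hle cuspMeetsH).piTpXH.map ((ContinuousMulEquiv.refl (Pi C)).trans
              (ContinuousMulEquiv.refl (Pi C))).toMulEquiv.toMonoidHom)
      (_hOut : ∀ g : (StableCurveTemperedData.ofSpecialFibre _ (C.groupLevelDataXuu C.l_ne_zero d₀) Sf h36 Sigma SigmaHat
            hsub hne hprime hpS TpH HatH hle cuspMeetsH).PiTp,
        ∃ δ : (StableCurveTemperedData.ofSpecialFibre _ (C.groupLevelDataXuu C.l_ne_zero d₀) Sf h36 Sigma SigmaHat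
            hsub hne hprime hpS TpH HatH hle cuspMeetsH).DeltaTp,
          MulAut.conj g • ((StableCurveTemperedData.ofSpecialFibre _ (C.groupLevelDataXuu C.l_ne_zero d₀) Sf h36 Sigma
                SigmaHat hsub hne hprime hpS TpH HatH hle cuspMeetsH).deltaTpH.map
              (StableCurveTemperedData.ofSpecialFibre _ (C.groupLevelDataXuu C.l_ne_zero d₀) Sf h36 Sigma SigmaHat hsub
                hne hprime hpS TpH HatH hle cuspMeetsH).DeltaTp.subtype) =
            MulAut.conj (δ : (StableCurveTemperedData.ofSpecialFibre _ (C.groupLevelDataXuu C.l_ne_zero d₀) Sf h36 Sigma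
                SigmaHat hsub hne hprime hpS TpH HatH hle cuspMeetsH).PiTp) •
              ((StableCurveTemperedData.ofSpecialFibre _ (C.groupLevelDataXuu C.l_ne_zero d₀) Sf h36 Sigma SigmaHat hsub
                  hne hprime hpS TpH HatH hle cuspMeetsH).deltaTpH.map
                (StableCurveTemperedData.ofSpecialFibre _ (C.groupLevelDataXuu C.l_ne_zero d₀) Sf h36 Sigma SigmaHat hsub
                  hne hprime hpS TpH HatH hle cuspMeetsH).DeltaTp.subtype)),
      Prop22_i' R T D' ι₀ := by
  intro hC hS K₀ C h15 L hO hYcl hp2 hpl hζ hη hZ Sb Env d₀ Sf h36 Sigma SigmaHat hsub hne hprime hpS TpH HatH hle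
    cuspMeetsH R T D' ι₀ hG hbullet hOut
  exact prop22_i'_xuu_genuineEnv_of_outer C μ hC hS h15 L hlp hp2 hpl hζ hη hZ d₀ Sf h36 Sigma SigmaHat hsub hne hprime
    hpS TpH HatH hle cuspMeetsH R T D' ι₀ hG hbullet hOut

end ModelTateCarriers

end Literature.IUT.HodgeArakelov

end
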